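import Mathlib
import Summits.PneNP.PneNP.Theorems.LatticeMagicBooleanSosBlindAtConstantFactorDefs

/-!
# PneNP / LatticeMagic — `BooleanSosBlindAtEveryFactor` (stmt-PneNP-16059): the scaled NO-instance

Helper file (`--supports stmt-PneNP-16059`) for the support item
`Summit.PneNP.PneNP.Theses.LatticeMagic.BooleanSosBlindAtEveryFactor` (factor-insensitivity of the
Boolean bit-SOS rung), road A of the planner's plan: the Construction-A instance of the proved crux
`BooleanSosBlindAtConstantFactor` (vocabulary `LatticeMagicBooleanSosBlindAtConstantFactorDefs.lean`:
`incBlock`, `rhsBit`, `XorUnsat`) with its CHECK BLOCK SCALED by an integer `M`: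

* basis rows `b_i = 2 e_i + M · Σ_{e : i ∈ scope (C e)} e_{N+e}` (`i < N`) and `b_{N+e} = 2M · e_{N+e}`,
  i.e. the block matrix `[[2·I_N, M·incBlock], [0, 2M·I_me]]`;
* target `t = (1, …, 1 | M · rhsBit (C e))`.

To stay definition-free, the basis `B` and target `t` are ARBITRARY data constrained by the six
block-entry hypotheses `hB₁₁ … ht₂` below; the closing file instantiates them with the concrete
reindexed block matrix. This file proves the GEOMETRY step (`scaled_no`): if the scope system is
integer-parity unsatisfiable (`XorUnsat N me C`) and `M ≠ 0`, then `det B = 2^N (2M)^me ≠ 0` and every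
lattice vector `z ᵥ* B` is at squared distance `≥ N + M²` from `t` — the `N` message coordinates
contribute odd squares `(2 z_i − 1)² ≥ 1`, and the check coordinate `e₀` supplied by `XorUnsat` for
`u = (z_i)_{i<N}` contributes `(M · w)²` with `w = Σ_i z_i [i ∈ scope (C e₀)] + 2 z_{N+e₀} − rhsBit ≠ 0`;
hence `((B, t), d₀)` is a NO-instance of `GapCVP_γ` as soon as `(γ(N + me) · d₀)² < N + M²`.

Sources for the construction: Conway–Sloane, *Sphere Packings, Lattices and Groups*, Construction A;
Micciancio–Goldwasser 2002, *Complexity of Lattice Problems*, Ch. 1 (`GapCVP`, Defs. 1.1, 1.5).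
Everything below is elementary linear algebra over `ℤ` (Mathlib only); nothing is cited as an axiom.
-/

set_option linter.dupNamespace false -- `Summit.PneNP.PneNP.…`: summit = sub-problem (D-0017)

namespace Summit.PneNP.PneNP.Theorems.ConAScaled

open scoped BigOperators Matrix
open Literature.Algebra.EuclideanLattices Literature.Computability.Complexity
  Literature.Computability.MetaComplexity Summit.PneNP.PneNP.Theorems.ConA

variable {N me : ℕ} (C : Fin me → Clause ℕ) (M : ℤ)
  (B : Matrix (Fin (N + me)) (Fin (N + me)) ℤ) (t : Fin (N + me) → ℤ)

/-! ## The block form of the scaled basis -/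

/-- A matrix with the six scaled Construction-A block entries IS the reindexed block matrix
`[[2·I_N, M·incBlock], [0, 2M·I_me]]`. (helper for `scaled_no`) -/
theorem scaled_eq_reindex
    (hB₁₁ : ∀ a' a : Fin N, B (Fin.castAdd me a') (Fin.castAdd me a) = if a' = a then 2 else 0)
    (hB₂₁ : ∀ (e' : Fin me) (a : Fin N), B (Fin.natAdd N e') (Fin.castAdd me a) = 0)
    (hB₁₂ : ∀ (a' : Fin N) (e : Fin me), B (Fin.castAdd me a') (Fin.natAdd N e) =
      if (a' : ℕ) ∈ clauseScope (C e) then M else 0)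
    (hB₂₂ : ∀ e' e : Fin me, B (Fin.natAdd N e') (Fin.natAdd N e) = if e' = e then 2 * M else 0) :
    B = Matrix.reindex finSumFinEquiv finSumFinEquiv
      (Matrix.fromBlocks (Matrix.diagonal fun _ => (2 : ℤ))
        (Matrix.of fun (a : Fin N) (e : Fin me) => if (a : ℕ) ∈ clauseScope (C e) then M else 0)
        0 (Matrix.diagonal fun _ => 2 * M)) := by
  ext i j
  induction i using Fin.addCases with
  | left a' =>
    induction j using Fin.addCases with
    | left a => simp [hB₁₁, Matrix.reindex_apply, Matrix.submatrix_apply, Matrix.diagonal_apply]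
    | right e => simp [hB₁₂, Matrix.reindex_apply, Matrix.submatrix_apply]
  | right e' =>
    induction j using Fin.addCases with
    | left a => simp [hB₂₁, Matrix.reindex_apply, Matrix.submatrix_apply]
    | right e => simp [hB₂₂, Matrix.reindex_apply, Matrix.submatrix_apply, Matrix.diagonal_apply]

/-- The scaled basis is block upper triangular with diagonal blocks `2·I_N`, `2M·I_me`, so
`det B = 2 ^ N · (2M) ^ me`. (helper for `scaled_no`) -/
theorem scaled_det
    (hB₁₁ : ∀ a' a : Fin N, B (Fin.castAdd me a') (Fin.castAdd me a) = if a' = a then 2 else 0)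
    (hB₂₁ : ∀ (e' : Fin me) (a : Fin N), B (Fin.natAdd N e') (Fin.castAdd me a) = 0)
    (hB₁₂ : ∀ (a' : Fin N) (e : Fin me), B (Fin.castAdd me a') (Fin.natAdd N e) =
      if (a' : ℕ) ∈ clauseScope (C e) then M else 0)
    (hB₂₂ : ∀ e' e : Fin me, B (Fin.natAdd N e') (Fin.natAdd N e) = if e' = e then 2 * M else 0) :
    B.det = 2 ^ N * (2 * M) ^ me := by
  rw [scaled_eq_reindex C M B hB₁₁ hB₂₁ hB₁₂ hB₂₂]
  simp only [Matrix.det_reindex_self, Matrix.det_fromBlocks_zero₂₁, Matrix.det_diagonal,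
    Finset.prod_const, Finset.card_univ, Fintype.card_fin]

/-! ## The coordinates of a lattice vector `z ᵥ* B`, in block form -/

/-- Message-block coordinate `a < N` of `z ᵥ* B`: `2 · z_a`. (helper for `scaled_no`) -/
theorem scaled_vecMul_castAdd
    (hB₁₁ : ∀ a' a : Fin N, B (Fin.castAdd me a') (Fin.castAdd me a) = if a' = a then 2 else 0)
    (hB₂₁ : ∀ (e' : Fin me) (a : Fin N), B (Fin.natAdd N e') (Fin.castAdd me a) = 0)
    (z : Fin (N + me) → ℤ) (a : Fin N) :
    (z ᵥ* B) (Fin.castAdd me a) = z (Fin.castAdd me a) * 2 := by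
  simp only [Matrix.vecMul, dotProduct]
  rw [Fin.sum_univ_add]
  simp [hB₁₁, hB₂₁, Finset.sum_ite_eq']

/-- Check-block coordinate `N + e` of `z ᵥ* B`: `M · (Σ_a z_a · [a ∈ scope (C e)]) + 2M · z_{N+e}`.
(helper for `scaled_no`) -/
theorem scaled_vecMul_natAdd
    (hB₁₂ : ∀ (a' : Fin N) (e : Fin me), B (Fin.castAdd me a') (Fin.natAdd N e) =
      if (a' : ℕ) ∈ clauseScope (C e) then M else 0)
    (hB₂₂ : ∀ e' e : Fin me, B (Fin.natAdd N e') (Fin.natAdd N e) = if e' = e then 2 * M else 0)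
    (z : Fin (N + me) → ℤ) (e : Fin me) :
    (z ᵥ* B) (Fin.natAdd N e) =
      M * (∑ a : Fin N, z (Fin.castAdd me a) * (if (a : ℕ) ∈ clauseScope (C e) then 1 else 0)) +
        z (Fin.natAdd N e) * (2 * M) := by
  simp only [Matrix.vecMul, dotProduct]
  rw [Fin.sum_univ_add]
  simp only [hB₁₂, hB₂₂, mul_ite, mul_zero, Finset.sum_ite_eq', Finset.mem_univ, if_true]
  congr 1
  rw [Finset.mul_sum]
  refine Finset.sum_congr rfl fun a _ => ?_
  split_ifs <;> ring

/-! ## The integer inequality -/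

/-- **Key integer inequality.** Under integer-parity unsatisfiability and `M ≠ 0`, every lattice
vector `z ᵥ* B` is at squared distance `≥ N + M²` from the target: each of the `N` message coordinates
contributes the square of the odd integer `2 z_a − 1`, and the check coordinate `e₀` supplied by
`XorUnsat` for `u = (z_a)_{a<N}` contributes `(M·w)²` with `w` a nonzero integer (no hypothesis on
`M` is needed here). (helper for `scaled_no`) -/
theorem scaled_key (hX : XorUnsat N me C)
    (hB₁₁ : ∀ a' a : Fin N, B (Fin.castAdd me a') (Fin.castAdd me a) = if a' = a then 2 else 0)
    (hB₂₁ : ∀ (e' : Fin me) (a : Fin N), B (Fin.natAdd N e') (Fin.castAdd me a) = 0)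
    (hB₁₂ : ∀ (a' : Fin N) (e : Fin me), B (Fin.castAdd me a') (Fin.natAdd N e) =
      if (a' : ℕ) ∈ clauseScope (C e) then M else 0)
    (hB₂₂ : ∀ e' e : Fin me, B (Fin.natAdd N e') (Fin.natAdd N e) = if e' = e then 2 * M else 0)
    (ht₁ : ∀ a : Fin N, t (Fin.castAdd me a) = 1)
    (ht₂ : ∀ e : Fin me, t (Fin.natAdd N e) = M * rhsBit (C e)) (z : Fin (N + me) → ℤ) :
    (N : ℤ) + M ^ 2 ≤ ∑ k, ((z ᵥ* B) k - t k) ^ 2 := by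
  rw [Fin.sum_univ_add]
  have h1 : ∀ a : Fin N, (1 : ℤ) ≤ ((z ᵥ* B) (Fin.castAdd me a) - t (Fin.castAdd me a)) ^ 2 := by
    intro a
    rw [scaled_vecMul_castAdd B hB₁₁ hB₂₁, ht₁]
    exact (one_le_sq_iff_one_le_abs _).mpr (Int.one_le_abs (by omega))
  have h2 : M ^ 2 ≤ ∑ e : Fin me, ((z ᵥ* B) (Fin.natAdd N e) - t (Fin.natAdd N e)) ^ 2 := by
    obtain ⟨e₀, he₀⟩ := hX fun a => z (Fin.castAdd me a)
    refine le_trans ?_ (Finset.single_le_sum (fun e _ => sq_nonneg _) (Finset.mem_univ e₀))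
    rw [scaled_vecMul_natAdd C M B hB₁₂ hB₂₂, ht₂]
    set w : ℤ := (∑ a : Fin N, z (Fin.castAdd me a) * (if (a : ℕ) ∈ clauseScope (C e₀) then 1 else 0))
      + 2 * z (Fin.natAdd N e₀) - rhsBit (C e₀) with hw
    have hw0 : w ≠ 0 := by
      intro h
      refine he₀ ⟨-z (Fin.natAdd N e₀), ?_⟩
      rw [hw] at h
      linarith
    have hw1 : 1 ≤ w ^ 2 := (one_le_sq_iff_one_le_abs _).mpr (Int.one_le_abs hw0)
    have hM2 : 0 ≤ M ^ 2 := sq_nonneg M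
    have heq : M * (∑ a : Fin N, z (Fin.castAdd me a) *
        (if (a : ℕ) ∈ clauseScope (C e₀) then 1 else 0)) + z (Fin.natAdd N e₀) * (2 * M) -
        M * rhsBit (C e₀) = M * w := by rw [hw]; ring
    rw [heq, mul_pow]
    nlinarith
  have h0 : (N : ℤ) ≤ ∑ a : Fin N, ((z ᵥ* B) (Fin.castAdd me a) - t (Fin.castAdd me a)) ^ 2 :=
    le_trans (by simp) (Finset.sum_le_sum fun a _ => h1 a)
  exact add_le_add h0 h2

/-! ## The distance bound -/

/-- `√(N + M²) ≤ dist(t, L(B))` for the scaled instance under integer-parity unsatisfiability.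
(helper for `scaled_no`) -/
theorem scaled_sqrt_le_infDist (hX : XorUnsat N me C)
    (hB₁₁ : ∀ a' a : Fin N, B (Fin.castAdd me a') (Fin.castAdd me a) = if a' = a then 2 else 0)
    (hB₂₁ : ∀ (e' : Fin me) (a : Fin N), B (Fin.natAdd N e') (Fin.castAdd me a) = 0)
    (hB₁₂ : ∀ (a' : Fin N) (e : Fin me), B (Fin.castAdd me a') (Fin.natAdd N e) =
      if (a' : ℕ) ∈ clauseScope (C e) then M else 0)
    (hB₂₂ : ∀ e' e : Fin me, B (Fin.natAdd N e') (Fin.natAdd N e) = if e' = e then 2 * M else 0)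
    (ht₁ : ∀ a : Fin N, t (Fin.castAdd me a) = 1)
    (ht₂ : ∀ e : Fin me, t (Fin.natAdd N e) = M * rhsBit (C e)) (d₀ : ℚ) :
    √((N : ℝ) + (M : ℝ) ^ 2) ≤
      Metric.infDist ((⟨⟨N + me, B⟩, t⟩, d₀) : GapCVPInstance).1.targetE
        ((⟨⟨N + me, B⟩, t⟩, d₀) : GapCVPInstance).1.I.lattice := by
  refine (Metric.le_infDist ⟨0, zero_mem _⟩).2 fun x hx => ?_
  obtain ⟨z, rfl⟩ := (LatticeInstance.mem_lattice_iff _ x).1 hx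
  rw [dist_eq_norm]
  change √((N : ℝ) + (M : ℝ) ^ 2) ≤ ‖intVecToEuclidean (N + me) t -
    intVecToEuclidean (N + me) (z ᵥ* B)‖
  rw [← map_sub, norm_intVecToEuclidean]
  refine Real.sqrt_le_sqrt ?_
  have h : (((N : ℤ) + M ^ 2 : ℤ) : ℝ) ≤ ((∑ k, ((z ᵥ* B) k - t k) ^ 2 : ℤ) : ℝ) :=
    Int.cast_le.2 (scaled_key C M B t hX hB₁₁ hB₂₁ hB₁₂ hB₂₂ ht₁ ht₂ z)
  push_cast at h
  refine h.trans_eq (Finset.sum_congr rfl fun k _ => ?_)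
  rw [Pi.sub_apply, Int.cast_sub]
  ring

/-! ## The NO-instance -/

/-- **The scaled NO-instance.** Integer-parity unsatisfiability and `M ≠ 0` make the scaled
Construction-A instance `((B, t), d₀)` a NO-instance of `GapCVP_γ` for every threshold `0 < d₀` with
`(γ(N + me) · d₀)² < N + M²` (and `γ(N + me) ≥ 0`): `det B = 2^N (2M)^me ≠ 0`, and every lattice
vector `z ᵥ* B` has `‖z ᵥ* B − t‖² ≥ N + M² > (γ · d₀)²`. (Conway–Sloane Construction A;
Micciancio–Goldwasser 2002, Ch. 1.) -/
theorem scaled_no (hX : XorUnsat N me C) (hM : M ≠ 0)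
    (hB₁₁ : ∀ a' a : Fin N, B (Fin.castAdd me a') (Fin.castAdd me a) = if a' = a then 2 else 0)
    (hB₂₁ : ∀ (e' : Fin me) (a : Fin N), B (Fin.natAdd N e') (Fin.castAdd me a) = 0)
    (hB₁₂ : ∀ (a' : Fin N) (e : Fin me), B (Fin.castAdd me a') (Fin.natAdd N e) =
      if (a' : ℕ) ∈ clauseScope (C e) then M else 0)
    (hB₂₂ : ∀ e' e : Fin me, B (Fin.natAdd N e') (Fin.natAdd N e) = if e' = e then 2 * M else 0)
    (ht₁ : ∀ a : Fin N, t (Fin.castAdd me a) = 1)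
    (ht₂ : ∀ e : Fin me, t (Fin.natAdd N e) = M * rhsBit (C e)) (d₀ : ℚ) (hd0 : 0 < d₀)
    (γ : ℕ → ℝ) (hγ : 0 ≤ γ (N + me)) (hgap : (γ (N + me) * (d₀ : ℝ)) ^ 2 < N + (M : ℝ) ^ 2) :
    ((⟨⟨N + me, B⟩, t⟩, d₀) : GapCVPInstance) ∈ GapCVP.no γ := by
  refine ⟨?_, hd0, ?_⟩
  · change B.det ≠ 0
    rw [scaled_det C M B hB₁₁ hB₂₁ hB₁₂ hB₂₂]
    have h2M : (2 * M) ≠ 0 := mul_ne_zero two_ne_zero hM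
    exact mul_ne_zero (pow_ne_zero _ two_ne_zero) (pow_ne_zero _ h2M)
  · change γ (N + me) * ((d₀ : ℚ) : ℝ) < _
    have h0 : 0 ≤ γ (N + me) * ((d₀ : ℚ) : ℝ) := mul_nonneg hγ (by exact_mod_cast hd0.le)
    have h1 : γ (N + me) * ((d₀ : ℚ) : ℝ) < √((N : ℝ) + (M : ℝ) ^ 2) := (Real.lt_sqrt h0).2 hgap
    exact h1.trans_le (scaled_sqrt_le_infDist C M B t hX hB₁₁ hB₂₁ hB₁₂ hB₂₂ ht₁ ht₂ d₀)

end Summit.PneNP.PneNP.Theorems.ConAScaled
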